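import Mathlib.Algebra.Group.Subgroup.Basic
import Literature.IUT.HodgeTheaters.FPrimeStrips
import Literature.IUT.HodgeTheaters.ConventionsTemperoids

/-!
# [IUTchI] §5, Definition 5.2 (v)–(viii): local `∞κ`-coric structures of `ℱ`-prime-strips

Mochizuki, *Inter-universal Teichmüller theory I*, §5, Definition 5.2 (v), (vi) pp. 135–138
(nonarchimedean `v`) and (vii), (viii) pp. 138–142 (archimedean `v`), Remark 5.2.3 p. 143, kurims
manuscript (May 2020) ([IUTchI] Def 5.2 (v)-(viii) pp.135-142) [claim: Mochizuki2012, status: disputed].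

Items (v)–(viii) are *reconstruction statements*: from `π₁(‡𝒟_v)` (resp. the Aut-holomorphic space
`‡𝒟_v`) one "may construct group-theoretically [algorithmically] … in a functorial fashion" the objects
`‡𝒟̄_v` ("corresponding to `C_v`"), `π₁^{rat}(‡𝒟_v) ↠ π₁(‡𝒟̄_v)`, the ind-topological monoid `𝕄_v(‡𝒟_v)`
("naturally isomorphic to `𝒪^▷_{F̄_v}`", [AbsTopIII] Cor 1.10 (b)–(d′)) resp. `𝕄_v(‡𝒟_v) ⊆ 𝔸_{‡𝒟_v}` ("`𝒪^▷_ℂ`",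
[AbsTopIII] Cor 2.7), and the pseudo-monoids `𝕄_{κv} ⊆ 𝕄_{∞κv} ⊆ 𝕄_{∞κ×v}` of κ-, `∞κ`-, `∞κ×`-coric rational
functions (Rmk 3.1.7); for an `ℱ`-prime-strip `‡𝔉` over `‡𝔇` an **`∞κ`-coric structure** on `‡ℱ_v` is a pair
`π₁^{rat}(‡𝒟_v) ↷ ‡𝕄_{∞κv}` isomorphic to the model pair, and the boxed claims are: "`‡ℱ_v` always admits an
`∞κ`-coric (respectively, `∞κ×`-coric) structure, which is, moreover, unique up to a uniquely
determined isomorphism" (via the unique isomorphism of cyclotomes `μ^Θ_Ẑ(π₁(‡𝒟_v)) ⥲ μ_Ẑ(‡𝕄_{∞κ×v})`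
and "`ℚ_{>0} ∩ Ẑ^× = {1}`"), "any `∞κ×`-coric structure determines an associated `∞κ`-coric structure"
(torsion restriction at strictly critical points), and the "functorial algorithm for reconstructing the
submonoid of `π₁(‡𝒟̄_v)`- [resp. `Aut(‡𝒟_v)`-] invariants of `‡𝕄_v^{gp}`, together with the ind-topological
[resp. topological] field structure". Following the cell's rule these are packaged as the interface
`CoricKit` over `FKit` (one field per named object / boxed claim, quoting print;
TODO-merge:abc-iut-L4-t1/t2 for [AbsTopIII], abc-iut-L5-t2 for Rmk 3.1.7), with the elementary
observation `ℚ_{>0} ∩ Ẑ^× = {1}` available PROVED in the tree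
(`Literature.IUT.LogThetaLattice.Rat.eq_one_of_forall_padicValRat_eq_zero`, cited by name). An `∞κ×`-coric structure is rendered as a triple
(carrier with `π₁^{rat}`-action, pseudo-monoid structure — abc-iut-L5-t1's `PartialMul` —, Kummer map
to `lim→_H H¹(H, μ^Θ_Ẑ(π₁(‡𝒟_v)))`), and "unique up to a uniquely determined isomorphism" as: exactly one
equivariant bijection compatible with the Kummer maps (audit abc-iut-L5-t6 R7-L5t4-F2: uniqueness of a
bare equivariant bijection would be false for the intended objects, `f ↦ c·f`).

Remark 5.2.3 ("when `v ∈ 𝕍^bad`, it is natural to take the decomposition groups corresponding to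
strictly critical points … to be [those] that correspond to … the image of the zero-labeled evaluation
points", p. 143) is a convention recorded in the docstring of `CoricKit.criticalDecomp`.
-/

namespace Literature.IUT.HodgeTheaters

open CategoryTheory

universe u

/-! `ℚ_{>0} ∩ Ẑ^× = {1}` ([IUTchI] Def 5.2 (vi) p. 137; Ex 5.1 (v) p. 127), in the elementary form in
which it is used (a positive rational number whose `p`-adic valuation vanishes for every prime `p`
equals `1`), is ALREADY PROVED in the tree as
`Literature.IUT.LogThetaLattice.Rat.eq_one_of_forall_padicValRat_eq_zero` (abc-iut-L6,
`RemarksArithmetic.lean`; not imported — nothing here uses it); it is not restated here. -/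

namespace PMBaseKit

variable {l : ℕ} {K : PMBaseKit.{u} l} {M : K.MultKit} (FK : K.FKit M)

/-- **Definition 5.2 (v)–(viii) as an interface** over the `ℱ`-prime-strip kit: the local objects
reconstructed from `‡𝒟_v` and the boxed claims on `∞κ`-coric structures, one field per named object /
displayed claim ([IUTchI] Def 5.2 (v)–(viii) pp. 135–142; inputs [AbsTopIII] Thm 1.9, Cor 1.10, 2.7,
Prop 1.6, Rmk 3.1.7; TODO-merge:abc-iut-L4-t1/t2, abc-iut-L5-t2). The nonarchimedean ((v), (vi)) and
archimedean ((vii), (viii)) cases are recorded uniformly; the docstrings quote both.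
([IUTchI] Def 5.2 (v)-(viii) pp.135-142) [claim: Mochizuki2012, status: disputed] -/
structure CoricKit where
  /-- `π₁(X)` for an object of the ambient category at `v` (a tempered / profinite group for `v ∈ 𝕍^non`;
  for `v ∈ 𝕍^arc` the group `π₁^{rat}` of deck transformations of (vii) is `pi1rat` below) -/
  pi1 : ∀ v, K.Amb v → Type u
  /-- group structure -/
  [grp : ∀ v X, Group (pi1 v X)]
  /-- (v)/(vii) `‡𝒟̄_v`: "a profinite group corresponding to `C_v` … which contains `π₁(‡𝒟_v)` as an open
  subgroup [openness/inclusion not recorded here]; we write `‡𝒟̄_v` for `ℬ(−)⁰` of this profinite group" /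
  "an Aut-holomorphic orbispace `‡𝒟̄_v` corresponding to `C_v`", with "a natural morphism `‡𝒟_v → ‡𝒟̄_v`"
  ([IUTchI] Def 5.2 (v) p. 135, (vii) p. 138) -/
  Dbar : ∀ v, K.Amb v → K.Amb v
  /-- the natural morphism `‡𝒟_v → ‡𝒟̄_v` -/
  toDbar : ∀ v (X : K.Amb v), X ⟶ Dbar v X
  /-- (v)/(vii) `π₁^{rat}(‡𝒟_v) (↠ π₁(‡𝒟̄_v))`, "an isomorph of the étale fundamental group … of the scheme
  obtained by base-changing to `(F_mod)_v` the generic point of `C_{F_mod}`" / the deck transformations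
  of the projective system `‡𝒟^{rat}_v → ‡𝒟̄_v` ([IUTchI] Def 5.2 (v) p. 135, (vii) pp. 139, 141) -/
  pi1rat : ∀ v, K.Amb v → Type u
  /-- group structure -/
  [grpRat : ∀ v X, Group (pi1rat v X)]
  /-- the natural surjection `π₁^{rat}(‡𝒟_v) ↠ π₁(‡𝒟̄_v)` -/
  ratSurj : ∀ v (X : K.Amb v), pi1rat v X →* pi1 v (Dbar v X)
  /-- the natural homomorphism `π₁^{rat}(‡𝒟_v) ↠ π₁(‡𝒟̄_v)` is surjective ([IUTchI] Def 5.2 (v) p. 135) -/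
  ratSurj_surjective : ∀ v (X : K.Amb v), Function.Surjective (ratSurj v X)
  /-- (v)/(vii) `𝕄_v(‡𝒟_v)`: "an ind-topological monoid [which is naturally isomorphic to `𝒪^▷_{F̄_v}`]
  equipped with its natural `π₁(‡𝒟̄_v)`-action" ([AbsTopIII] Cor 1.10 (b)–(d′)) / "the topological
  submonoid [of `𝔸_{‡𝒟_v}`] consisting of nonzero elements of norm `≤ 1` [i.e., `𝒪^▷_ℂ`]" ([IUTchI] Def 5.2
  (v) p. 135, (vii) p. 139) -/
  Mloc : ∀ v, K.Amb v → Type u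
  /-- monoid structure -/
  [monM : ∀ v X, CommMonoid (Mloc v X)]
  /-- the `π₁(‡𝒟̄_v)`-action -/
  [actM : ∀ v X, MulAction (pi1 v (Dbar v X)) (Mloc v X)]
  /-- (v)/(vii) the pseudo-monoids `𝕄_{κv}(‡𝒟_v) ⊆ 𝕄_{∞κv}(‡𝒟_v) ⊆ 𝕄_{∞κ×v}(‡𝒟_v)` "of κ-, `∞κ`-, and
  `∞κ×`-coric rational functions associated to `C_v` … equipped with their natural `π₁^{rat}(‡𝒟_v)`-actions"
  / "pseudo-monoids of 'meromorphic functions'" ([IUTchI] Def 5.2 (v) p. 135, (vii) p. 139): the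
  largest, with the two others as subsets -/
  Minfkx : ∀ v, K.Amb v → Type u
  /-- the `π₁^{rat}`-action -/
  [actInfkx : ∀ v X, MulAction (pi1rat v X) (Minfkx v X)]
  /-- `𝕄_{∞κv} ⊆ 𝕄_{∞κ×v}` -/
  Minfk : ∀ v (X : K.Amb v), Set (Minfkx v X)
  /-- "`𝕄_{κv}(‡𝒟_v)` may be identified with the subset of `π₁^{rat}(‡𝒟_v)`-invariants of `𝕄_{∞κv}(‡𝒟_v)`" -/
  Mkappa : ∀ v (X : K.Amb v), Set (Minfkx v X)
  /-- the printed identification of `𝕄_{κv}` -/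
  Mkappa_eq : ∀ v, v ∉ K.arc → ∀ (X : K.Amb v),
    Mkappa v X = {f ∈ Minfk v X | ∀ g : pi1rat v X, g • f = f}
  /-- for `v ∈ 𝕍^arc` the print characterises `𝕄_{κv} ⊆ 𝕄_{∞κv}` instead as "the subset of elements that
  descend to some co-finite open sub-orbispace of `‡𝒟̄_v` and, moreover, are equivariant with respect to
  the unique embedding `Aut(‡𝒟̄_v) ↪ Aut(𝔸_{‡𝒟_v})`" ([IUTchI] Def 5.2 (vii) p. 139, (viii) p. 140): recorded
  only as the inclusion (the descent/equivariance predicate is left open) -/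
  Mkappa_subset_arc : ∀ v, v ∈ K.arc → ∀ (X : K.Amb v), Mkappa v X ⊆ Minfk v X
  /-- "`𝕄_v(‡𝒟_v)^×` may be identified with `𝕄_{∞κ×v}(‡𝒟_v)^×`" ([IUTchI] Def 5.2 (v) p. 136, (vii) p. 139:
  "both … isomorphic, as abstract topological monoids, to `𝕊¹`" for `v ∈ 𝕍^arc`): the units of `𝕄_v` as
  constants -/
  unitsIncl : ∀ v (X : K.Amb v), (Mloc v X)ˣ → Minfkx v X
  /-- injectivity of the identification -/
  unitsIncl_injective : ∀ v (X : K.Amb v), Function.Injective (unitsIncl v X)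
  /-- (vi)/(viii) for an `ℱ`-prime-strip constituent `‡ℱ_v` with base `‡𝒟_v`: the monoid `‡𝕄_v` — "an
  ind-topological monoid equipped with a continuous action by `π₁(‡𝒟̄_v)` that is isomorphic … to the
  pair `π₁(‡𝒟̄_v) ↷ 𝕄_v(‡𝒟_v)`", related to `‡ℱ_v` "via the unique isomorphism … [Cor 5.3 (ii)] between `‡ℱ_v`
  and the `p_v`-adic Frobenioid determined by the pair" / "the topological monoid [`𝒪^▷(‡𝒞_v)`] that
  appears as the domain of the Kummer structure", with "the Kummer structure isomorphism
  `𝕄_v(‡𝒟_v) ⥲ ‡𝕄_v`" ([IUTchI] Def 5.2 (vi) p. 136, (viii) p. 140) -/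
  Mstrip : ∀ v, FK.FAmb v → Type u
  /-- monoid structure -/
  [monMstrip : ∀ v F, CommMonoid (Mstrip v F)]
  /-- the Kummer-structure isomorphism `𝕄_v(‡𝒟_v) ⥲ ‡𝕄_v` (for `‡𝒟_v` the base of `‡ℱ_v`) -/
  kummerIso : ∀ v (F : FK.FAmb v), Mloc v ((FK.toD v).obj F) ≃* Mstrip v F
  /-- (v)/(vii) the pseudo-monoid structure of `𝕄_{∞κ×v}(‡𝒟_v)` ([IUTchI] Def 5.2 (v) p. 135 "pseudo-monoids
  of κ-, `∞κ`-, and `∞κ×`-coric rational functions"; §0 p. 33, abc-iut-L5-t1's `PartialMul`) -/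
  mulInfkx : ∀ v (X : K.Amb v), PartialMul (Minfkx v X)
  /-- it is a pseudo-monoid in the sense of §0 -/
  mulInfkx_isPseudoMonoid : ∀ v (X : K.Amb v), (mulInfkx v X).IsPseudoMonoid
  /-- (vi)/(viii) the natural receptacle `lim→_H H¹(H, μ^Θ_Ẑ(π₁(‡𝒟_v)))` of Kummer classes, "where `H`
  ranges over the open subgroups of `π₁^{rat}(‡𝒟_v)`" and `μ^Θ_Ẑ(π₁(‡𝒟_v))` is the cyclotome constructed
  from `π₁(‡𝒟_v)` by [AbsTopIII] Thm 1.9 / [EtTh] Cor 2.19 ([IUTchI] Def 5.2 (vi) p. 137; (viii)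
  p. 141 with systems of Kummer coverings in place of open subgroups), with its `π₁^{rat}`-action -/
  KumH1 : ∀ v, K.Amb v → Type u
  /-- the action on the receptacle of Kummer classes -/
  [actKum : ∀ v X, MulAction (pi1rat v X) (KumH1 v X)]
  /-- the Kummer map of the model pseudo-monoid `𝕄_{∞κ×v}(‡𝒟_v) → lim→_H H¹(H, μ^Θ_Ẑ(π₁(‡𝒟_v)))`
  (through "the natural isomorphism `μ^Θ_Ẑ(π₁(‡𝒟_v)) ⥲ μ_Ẑ(𝕄_{∞κ×v}(‡𝒟_v))`", [IUTchI] Def 5.2 (vi)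
  p. 137) -/
  kummer : ∀ v (X : K.Amb v), Minfkx v X → KumH1 v X
  /-- the Kummer map is equivariant -/
  kummer_smul : ∀ v (X : K.Amb v) (g : pi1rat v X) (f : Minfkx v X),
    kummer v X (g • f) = g • kummer v X f
  /-- `𝕄_{∞κ×v}` is Kummer-ready ([IUTchI] Rmk 5.1.3): its Kummer map is injective -/
  kummer_injective : ∀ v (X : K.Amb v), Function.Injective (kummer v X)
  /-- (vi)/(viii) **`∞κ×`-coric structure** on `‡ℱ_v`: a pair `π₁^{rat}(‡𝒟_v) ↷ ‡𝕄_{∞κ×v}` "isomorphic [as a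
  pair consisting of a pseudo-monoid equipped with a continuous action by `π₁^{rat}(‡𝒟_v)`] to the pair
  `π₁^{rat}(‡𝒟_v) ↷ 𝕄_{∞κ×v}(‡𝒟_v)`", each such pair coming with its Kummer map to
  `lim→_H H¹(H, μ_Ẑ(‡𝕄_{∞κ×v})) ⥲ lim→_H H¹(H, μ^Θ_Ẑ(π₁(‡𝒟_v)))` via "a unique isomorphism of cyclotomes
  `μ^Θ_Ẑ(π₁(‡𝒟_v)) ⥲ μ_Ẑ(‡𝕄_{∞κ×v})`" ([IUTchI] Def 5.2 (vi) pp. 136–137, (viii) pp. 140–141): the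
  predicate on (carrier with action, pseudo-monoid structure, Kummer map) -/
  IsInfkxCoric : ∀ v (X : K.Amb v) (P : Type u) [MulAction (pi1rat v X) P],
    PartialMul P → (P → KumH1 v X) → Prop
  /-- the model pair, with its pseudo-monoid structure and Kummer map, is `∞κ×`-coric -/
  isInfkxCoric_model : ∀ v (X : K.Amb v), IsInfkxCoric v X (Minfkx v X) (mulInfkx v X) (kummer v X)
  /-- (vi)/(viii) "`‡ℱ_v` always admits an `∞κ`-coric (respectively, `∞κ×`-coric) structure, which is,
  moreover, **unique up to a uniquely determined isomorphism** [i.e., of pseudo-monoids equipped with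
  continuous actions by `π₁^{rat}(‡𝒟_v)`]" ([IUTchI] Def 5.2 (vi) p. 137: "since … isomorphic to
  `μ^Θ_Ẑ(π₁(‡𝒟_v))` … compatible with the … Kummer classes … it follows immediately from the elementary
  observation that `ℚ_{>0} ∩ Ẑ^× = {1}` …"; (viii) pp. 141–142): between two `∞κ×`-coric structures there
  is exactly one equivariant bijection compatible with the Kummer maps (it then respects the
  pseudo-monoid structures, the Kummer maps being injective and multiplicative) -/
  infkxCoric_unique : ∀ v (X : K.Amb v) (P Q : Type u) [MulAction (pi1rat v X) P]
    [MulAction (pi1rat v X) Q] (μP : PartialMul P) (κP : P → KumH1 v X) (μQ : PartialMul Q)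
    (κQ : Q → KumH1 v X), IsInfkxCoric v X P μP κP → IsInfkxCoric v X Q μQ κQ →
      ∃! e : P ≃ Q, (∀ (g : pi1rat v X) (x : P), e (g • x) = g • e x) ∧ ∀ x, κQ (e x) = κP x
  /-- (vi)/(viii) the decomposition groups [resp. systems of points] of strictly critical points used
  to cut out `∞κ` inside `∞κ×` ("the restriction of the associated Kummer class to some [or,
  equivalently, every — cf. Remark 5.2.3] subgroup of `π₁^{rat}(‡𝒟_v)` that corresponds to an open
  subgroup of the decomposition group of some strictly critical point of `C_v`"; Rmk 5.2.3 p. 143: at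
  `v ∈ 𝕍^bad` "the point of `C_v` that arises as the image of the zero-labeled evaluation points")
  ([IUTchI] Def 5.2 (vi) p. 138, (viii) p. 142) -/
  criticalDecomp : ∀ v (X : K.Amb v), Set (Subgroup (pi1rat v X))
  /-- (vi)/(viii) "any `∞κ×`-coric structure … determines an associated `∞κ`-coric structure
  `‡𝕄_{∞κv} ⊆ ‡𝕄_{∞κ×v}` by considering the subset of elements for which the restriction … to [a critical
  decomposition group] is a torsion element": the torsion-restriction test, supplied on the model -/
  IsTorsionAt : ∀ v (X : K.Amb v), Subgroup (pi1rat v X) → Minfkx v X → Prop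
  /-- the displayed characterisation of `𝕄_{∞κv} ⊆ 𝕄_{∞κ×v}` ("some [or, equivalently, every]") -/
  minfk_eq : ∀ v (X : K.Amb v) (f : Minfkx v X),
    f ∈ Minfk v X ↔ (∃ H ∈ criticalDecomp v X, IsTorsionAt v X H f) ∧
      ∀ H ∈ criticalDecomp v X, IsTorsionAt v X H f
  /-- (vi)/(viii) "the operation of restricting Kummer classes … arising from `‡𝕄_{κv} ⊆ ‡𝕄_{∞κv}` to
  [decomposition groups / systems of points] of non-critical `(F_mod)_v`-valued points [resp.
  `Aut(‡𝒟_v)`-invariant non-critical points] … yields a functorial algorithm for reconstructing the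
  submonoid of `π₁(‡𝒟̄_v)`- [resp. `Aut(‡𝒟_v)`-] invariants of `‡𝕄^{gp}_v`, together with the
  [ind-]topological field structure on the union of this monoid with `{0}`" ([IUTchI] Def 5.2 (vi)
  p. 138, (viii) p. 142): the evaluation at non-critical points, valued in the invariants -/
  evalNonCritical : ∀ v (X : K.Amb v), Mkappa v X →
    Set {x : Mloc v X | ∀ g : pi1 v (Dbar v X), g • x = x}
  /-- (vii) for `v ∈ 𝕍^arc`: "a natural isomorphism `Aut(‡𝒟̄_v) ⥲ Gal(K_v/(F_mod)_v) (↪ ℤ/2ℤ)` — i.e.,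
  obtained by considering whether an automorphism of `‡𝒟̄_v` is holomorphic or anti-holomorphic"
  ([IUTchI] Def 5.2 (vii) pp. 138–139): the holomorphic/anti-holomorphic character -/
  autDbarSign : ∀ v, v ∈ K.arc → ∀ X : K.Amb v, Aut (Dbar v X) →* Multiplicative (ZMod 2)
  /-- the character `Aut(‡𝒟̄_v) ↪ ℤ/2ℤ` is injective -/
  autDbarSign_injective : ∀ v (h : v ∈ K.arc) (X : K.Amb v), Function.Injective (autDbarSign v h X)
  /-- (vii) `𝔸_{‡𝒟_v}`, "the complex archimedean topological field" with "`Aut(𝔸_{‡𝒟_v})` … (≅ ℤ/2ℤ)" and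
  `𝕄_v(‡𝒟_v) ⊆ 𝔸_{‡𝒟_v}`, "`𝔸_{‡𝒟_v}` may be identified with the union with `{0}` of the groupification
  `𝕄_v(‡𝒟_v)^{gp}`" ([IUTchI] Def 5.2 (vii) p. 139; [AbsTopIII] Cor 2.7 (e)) -/
  Afield : ∀ v, v ∈ K.arc → K.Amb v → Type u
  /-- field structure -/
  [fieldA : ∀ v h X, Field (Afield v h X)]
  /-- `𝕄_v(‡𝒟_v) ⊆ 𝔸_{‡𝒟_v}` as a multiplicative map -/
  mlocToA : ∀ v h (X : K.Amb v), Mloc v X →* Afield v h X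
  /-- injectivity -/
  mlocToA_injective : ∀ v h (X : K.Amb v), Function.Injective (mlocToA v h X)

attribute [instance] CoricKit.grp CoricKit.grpRat CoricKit.monM CoricKit.actM CoricKit.actInfkx
  CoricKit.actKum CoricKit.monMstrip CoricKit.fieldA

namespace CoricKit

variable {FK} (C : CoricKit FK)

/-- The **`∞κ`-coric structure determined by an `∞κ×`-coric structure** ([IUTchI] Def 5.2 (vi) p. 138,
(viii) p. 142): on the model pair, the subset cut out by the torsion test at critical decomposition
groups — i.e. `𝕄_{∞κv}` (`infkOfInfkx_eq`). ([IUTchI] Def 5.2 (vi) p.138) [claim: Mochizuki2012, status: disputed] -/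
def infkOfInfkx (v : K.V) (X : K.Amb v) : Set (C.Minfkx v X) :=
  {f | ∀ H ∈ C.criticalDecomp v X, C.IsTorsionAt v X H f}

/-- On the model, the `∞κ`-coric structure determined by the `∞κ×`-coric structure is `𝕄_{∞κv}`
whenever critical decomposition groups exist ("some [or, equivalently, every]"). PROVED from the
interface. ([IUTchI] Def 5.2 (vi) p.138) [claim: Mochizuki2012, status: disputed] -/
theorem infkOfInfkx_eq (v : K.V) (X : K.Amb v) (hne : (C.criticalDecomp v X).Nonempty) :
    C.infkOfInfkx v X = C.Minfk v X := by
  ext f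
  rw [C.minfk_eq]
  constructor
  · intro h
    obtain ⟨H, hH⟩ := hne
    exact ⟨⟨H, hH, h H hH⟩, h⟩
  · intro h
    exact h.2

/-- `‡𝕄_{κv} ⊆ ‡𝕄_{∞κv}`, "the 'sub-pseudo-monoid' of `π₁^{rat}(‡𝒟_v)`-invariants" [resp. "the subset of
elements that descend to some co-finite open sub-orbispace of `‡𝒟̄_v` and … are equivariant with respect
to the unique embedding `Aut(‡𝒟̄_v) ↪ Aut(𝔸_{‡𝒟_v})`"] ([IUTchI] Def 5.2 (vi) p. 138, (viii) p. 140): on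
the model, `𝕄_{κv} ⊆ 𝕄_{∞κv}`. PROVED from the interface. ([IUTchI] Def 5.2 (vi) p.138) [claim: Mochizuki2012, status: disputed] -/
theorem mkappa_subset_minfk (v : K.V) (X : K.Amb v) : C.Mkappa v X ⊆ C.Minfk v X := by
  by_cases hv : v ∈ K.arc
  · exact C.Mkappa_subset_arc v hv X
  · rw [C.Mkappa_eq v hv]
    exact fun f hf => hf.1

/-- The cyclotome `μ^Θ_Ẑ(‡𝒟_v) := Hom(ℚ/ℤ, 𝕄_v(‡𝒟_v)^{gp}) = Hom(ℚ/ℤ, 𝕄_v(‡𝒟_v)^μ) = Hom(ℚ/ℤ, 𝕄_v(‡𝒟_v)^×)`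
([IUTchI] Def 5.2 (viii) p. 140; the notation `μ_Ẑ((−)) := Hom(ℚ/ℤ, (−))` of Ex 5.1 (v) p. 127,
[AbsTopIII] Def 3.1 (v)): homomorphisms from a given model `QZ` of `ℚ/ℤ` into the units.
([IUTchI] Def 5.2 (viii) p.140) [claim: Mochizuki2012, status: disputed] -/
def cyclotome (QZ : Type u) [AddCommGroup QZ] (v : K.V) (X : K.Amb v) : Type u :=
  Multiplicative QZ →* (C.Mloc v X)ˣ

/-- "the Kummer structure isomorphism … induces a natural 'Kummer structure cyclotomic isomorphism'
`μ^Θ_Ẑ(‡𝒟_v) ⥲ μ_Ẑ(‡𝕄_v)`" ([IUTchI] Def 5.2 (viii) p. 140): post-composition with the units of the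
Kummer-structure isomorphism. ([IUTchI] Def 5.2 (viii) p.140) [claim: Mochizuki2012, status: disputed] -/
def kummerCyclotomicIso (QZ : Type u) [AddCommGroup QZ] (v : K.V) (F : FK.FAmb v) :
    C.cyclotome QZ v ((FK.toD v).obj F) → (Multiplicative QZ →* (C.Mstrip v F)ˣ) :=
  fun χ => (Units.map (C.kummerIso v F).toMonoidHom).comp χ

end CoricKit

/-! ### Consistency: a model of `CoricKit` over the toy kits -/

/-- A model of the `∞κ`-coric kit over `PMBaseKit.toyKit` / `FKit.toy` (prime `l ≠ 2`): trivial groups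
and monoids, all pseudo-monoids `PUnit`, one (improper) critical decomposition group, `𝔸 = 𝔽_l` —
witnessing that `CoricKit` has honest inhabitants ([IUTchI] Def 5.2 (v) p. 135).
([IUTchI] Def 5.2 (v) p.135) [claim: Mochizuki2012, status: disputed] -/
noncomputable def CoricKit.toy (l : ℕ) [Fact l.Prime] (hl : l ≠ 2) : CoricKit (FKit.toy l hl) where
  pi1 _ _ := PUnit
  Dbar _ X := X
  toDbar _ X := 𝟙 X
  pi1rat _ _ := PUnit
  ratSurj _ _ := 1
  ratSurj_surjective _ _ := fun _ => ⟨PUnit.unit, rfl⟩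
  Mloc _ _ := PUnit
  Minfkx _ _ := PUnit
  Minfk _ _ := Set.univ
  Mkappa _ _ := Set.univ
  Mkappa_eq _ _ _ := by ext x; simp
  Mkappa_subset_arc _ _ _ := fun _ h => h
  unitsIncl _ _ _ := PUnit.unit
  unitsIncl_injective _ _ := fun a b _ => Subsingleton.elim a b
  Mstrip _ _ := PUnit
  kummerIso _ _ := MulEquiv.refl _
  mulInfkx _ _ := ⟨Set.univ, fun _ => PUnit.unit⟩
  mulInfkx_isPseudoMonoid _ _ :=
    ⟨PUnit, inferInstance, id, ⟨fun _ _ h => h, by ext p; simp, fun _ => Subsingleton.elim _ _⟩⟩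
  KumH1 _ _ := PUnit
  kummer _ _ := id
  kummer_smul _ _ _ _ := rfl
  kummer_injective _ _ := fun _ _ h => h
  IsInfkxCoric _ _ P _ _ _ := Nonempty (P ≃ PUnit.{1})
  isInfkxCoric_model _ _ := ⟨Equiv.refl _⟩
  infkxCoric_unique _ _ P Q _ _ _ _ _ _ hP hQ := by
    obtain ⟨eP⟩ := hP
    obtain ⟨eQ⟩ := hQ
    haveI : Subsingleton Q := eQ.subsingleton
    haveI : Subsingleton P := eP.subsingleton
    exact ⟨eP.trans eQ.symm, ⟨fun _ _ => Subsingleton.elim _ _, fun _ => Subsingleton.elim _ _⟩,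
      fun e _ => Equiv.ext fun _ => Subsingleton.elim _ _⟩
  criticalDecomp _ _ := {⊤}
  IsTorsionAt _ _ _ _ := True
  minfk_eq _ _ _ := by simp
  evalNonCritical _ _ _ := ∅
  autDbarSign _ _ _ := 1
  autDbarSign_injective v h := absurd h (show v ∉ (∅ : Finset Unit) from Finset.notMem_empty v)
  Afield _ _ _ := ZMod l
  mlocToA _ _ _ := 1
  mlocToA_injective _ _ _ := fun a b _ => Subsingleton.elim a b

end PMBaseKit

end Literature.IUT.HodgeTheaters
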